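import Mathlib
import Literature.Probability.Percolation.PercolationProofs
import Literature.Probability.Percolation.KestenZhangPeierls
import Literature.Probability.LatticeModels.ZdBoxesLines
import HarnessLib

/-!
# Crux `PercBurnResprinkle.JumpFireBreak` (stmt-CriticalPhenomena-7204), line `vacant-coins-fresh-spine` — stub `stub_scaleStep`

Helper file for the crux skeleton `Cruxes/JumpFireBreak/Lines/vacant-coins-fresh-spine.lean` (lead
prover-line-stmt-CriticalPhenomena-7204-0).  Proves exactly the registered stub signature; lands with
`--supports stmt-CriticalPhenomena-7204`.

One step of the tower: coarse bad event ⇒ truncated arm somewhere or a ★-animal of `2L-5` bad fine blocks; Kesten–Zhang Peierls.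

Proof route.  Let `γ` be the coarse open crossing: a walk of the open graph inside
`{v | v - c ∈ box (3L²) ∧ small_L v}` from `a ∈ c + box (L²)` to `b` with `‖b - c‖_∞ = 3L²`.
Case A: a vertex of `γ` is not `small_r` — union bound over the `(6L²+1)³` points of `c + box (3L²)`.
Case B: all vertices of `γ` are `small_r`.  Block index `z(v) = ⌊(v - c + ⌊L/2⌋)/L⌋` (blocks of side `L`
centred at `c + L z`); stop `γ` where it first reaches sup-distance `3L² - 4L - 1` from `c` (`exists_walk_hit`);
from every vertex `x` of the stopped walk, `γ` goes on to cross the annulus `c_z + (box L, box 3L)` around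
the block centre `c_z` of `x` (`fine_cross`), so every block met is bad; the blocks met form a lazy `★`-chain
from `z(a) ∈ box L` reaching block distance `≥ 2L - 5`, hence `≥ 2L - 5` distinct blocks, and a shortest
prefix with exactly `2L - 5` blocks is `★`-connected through `z(a)`: a member of `starAnimals (z a) (2L - 5)`
(`mem_starAnimals`), priced by `measureReal_exists_starAnimal_bad_le` with the hypothesis `H1`; union bound
over `z(a) ∈ box L` (`ScaleStep.cross_cover` is the deterministic part).  No new definitions (the block
index is a function `z` with its defining equation `hz`).
-/

noncomputable section

namespace Summit.CriticalPhenomena.PercolationContinuityZ3.Theorems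

open MeasureTheory ProbabilityTheory Literature.Probability.Percolation Literature.Probability.LatticeModels

namespace ScaleStep

open SimpleGraph Relation

variable {V : Type*} {G : SimpleGraph V} {d L : ℕ} {c : Site d} {z : Site d → Site d}

/-- **First hit.** If `g` increases by at most one along every edge, a walk from a vertex with
`g ≤ n` to a vertex with `n ≤ g` has an initial piece (a walk with support inside the original
support) on which `g ≤ n` throughout and which ends at a vertex with `g = n` exactly. -/
theorem exists_walk_hit (g : V → ℕ) (hG : ∀ x y, G.Adj x y → g y ≤ g x + 1) {n : ℕ} :
    ∀ {u v : V} (p : G.Walk u v), g u ≤ n → n ≤ g v →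
      ∃ w, ∃ p' : G.Walk u w, p'.support ⊆ p.support ∧ (∀ x ∈ p'.support, g x ≤ n) ∧ g w = n
  | u, _, Walk.nil, hu, hv => ⟨u, Walk.nil, fun _ hx => hx, by simpa using hu, le_antisymm hu hv⟩
  | u, _, Walk.cons (v := w) h p, hu, hv => by
      by_cases hun : g u = n
      · exact ⟨u, Walk.nil, by simp, by simp [hun], hun⟩
      · obtain ⟨y, p', hp', hle, hy⟩ := exists_walk_hit g hG p (by have := hG u w h; omega) hv
        refine ⟨y, Walk.cons h p', ?_, ?_, hy⟩
        · rw [Walk.support_cons, Walk.support_cons]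
          exact List.cons_subset_cons u hp'
        · simp only [Walk.support_cons, List.mem_cons, forall_eq_or_imp]
          exact ⟨by omega, hle⟩

/-- **Discrete intermediate values along a chain.** If `g` increases by at most one between
consecutive entries of `x :: l`, `g x ≤ n`, and some entry has `g ≥ n`, then some entry has `g = n`. -/
theorem exists_mem_apply_eq_of_isChain {α : Type*} (g : α → ℕ) :
    ∀ (x : α) (l : List α), List.IsChain (fun a b => g b ≤ g a + 1) (x :: l) →
      ∀ n, g x ≤ n → (∃ y ∈ x :: l, n ≤ g y) → ∃ y ∈ x :: l, g y = n
  | x, [], _, n, hx, ⟨y, hy, hny⟩ => by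
      rw [List.mem_singleton] at hy
      exact ⟨x, List.mem_singleton_self _, le_antisymm hx (hy ▸ hny)⟩
  | x, x' :: l, h, n, hx, ⟨y, hy, hny⟩ => by
      by_cases hxn : g x = n
      · exact ⟨x, List.mem_cons_self, hxn⟩
      · obtain ⟨hr, h'⟩ := List.isChain_cons_cons.1 h
        have hy' : y ∈ x' :: l := by
          rcases List.mem_cons.1 hy with hyx | hy
          · rw [hyx] at hny; exact absurd (le_antisymm hx hny) hxn
          · exact hy
        obtain ⟨w, hw, hwn⟩ := exists_mem_apply_eq_of_isChain g x' l h' n (by omega) ⟨y, hy', hny⟩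
        exact ⟨w, List.mem_cons_of_mem _ hw, hwn⟩

/-- **Prefixes with a prescribed number of distinct entries.** A list with at least `m` distinct
entries has a prefix with exactly `m` distinct entries. -/
theorem exists_prefix_card_eq {α : Type*} [DecidableEq α] (l : List α) :
    ∀ m ≤ l.toFinset.card, ∃ l₁, l₁ <+: l ∧ l₁.toFinset.card = m := by
  induction l using List.reverseRecOn with
  | nil => intro m hm; exact ⟨[], ⟨[], rfl⟩, by simp only [List.toFinset_nil, Finset.card_empty] at hm ⊢; omega⟩
  | append_singleton l x ih =>
      intro m hm
      by_cases h : m ≤ l.toFinset.card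
      · obtain ⟨l₁, hl₁, hc⟩ := ih m h
        exact ⟨l₁, hl₁.trans (List.prefix_append _ _), hc⟩
      · refine ⟨l ++ [x], ⟨[], List.append_nil _⟩, le_antisymm ?_ hm⟩
        rw [List.toFinset_append]
        refine (Finset.card_union_le _ _).trans ?_
        simp only [List.toFinset_cons, List.toFinset_nil, insert_empty_eq, Finset.card_singleton]
        omega

/-- Along a lazy `★`-chain `x :: l` (consecutive entries at sup-distance `≤ 1`) inside `S`, every
entry is joined to `x` by a chain of `starRel S`-steps. -/
theorem reflTransGen_starRel_of_isChain {S : Set (Site d)} :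
    ∀ (x : Site d) (l : List (Site d)), List.IsChain (fun a b => supDist a b ≤ 1) (x :: l) →
      (∀ y ∈ x :: l, y ∈ S) → ∀ y ∈ x :: l, ReflTransGen (starRel S) x y
  | x, [], _, _, y, hy => by
      rw [List.mem_singleton] at hy
      rw [hy]
  | x, x' :: l, h, hS, y, hy => by
      obtain ⟨hr, h'⟩ := List.isChain_cons_cons.1 h
      rcases List.mem_cons.1 hy with hyx | hy'
      · rw [hyx]
      refine ReflTransGen.trans ?_
        (reflTransGen_starRel_of_isChain x' l h' (fun w hw => hS w (List.mem_cons_of_mem _ hw)) y hy')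
      by_cases heq : x = x'
      · rw [heq]
      · exact ReflTransGen.single
          ⟨zdStar_adj.2 ⟨heq, hr⟩, hS x List.mem_cons_self, hS x' (List.mem_cons_of_mem _ List.mem_cons_self)⟩

/-- **The set of entries of a lazy `★`-chain is `★`-connected.** -/
theorem starConn_of_isChain {l : List (Site d)} (hl : List.IsChain (fun a b => supDist a b ≤ 1) l) :
    StarConn {y | y ∈ l} := by
  cases l with
  | nil => intro x hx; simp at hx
  | cons x t =>
      intro y₁ hy₁ y₂ hy₂
      have h := reflTransGen_starRel_of_isChain (S := {y | y ∈ x :: t}) x t hl (fun y hy => hy)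
      exact (reflTransGen_starRel_symm (h y₁ hy₁)).trans (h y₂ hy₂)

/-- `x - c ∈ box n` iff `‖x - c‖_∞ ≤ n`. -/
theorem sub_mem_coe_box_iff {x c : Site d} {n : ℕ} : x - c ∈ (box d n : Set (Site d)) ↔ supDist x c ≤ n := by
  rw [Finset.mem_coe, mem_box, supDist_le_iff]
  exact forall_congr' fun i => by rw [Pi.sub_apply]; omega

/-- A `★`-step changes the sup-distance to a fixed point by at most one. -/
theorem supDist_le_succ_of_supDist_le_one {x y : Site d} (h : supDist x y ≤ 1) (c : Site d) :
    supDist y c ≤ supDist x c + 1 := by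
  have h1 := supDist_triangle y x c; rw [supDist_comm y x] at h1; omega

/-- The sup-distance is attained at a coordinate (`d = 3`). -/
theorem exists_natAbs_eq_supDist (x y : Site 3) : ∃ i, (x i - y i).natAbs = supDist x y :=
  let ⟨i, _, hi⟩ := Finset.exists_mem_eq_sup Finset.univ Finset.univ_nonempty fun i => (x i - y i).natAbs
  ⟨i, hi.symm⟩

/-- **Block index.** Throughout, `z x = ⌊(x - c + ⌊L/2⌋) / L⌋` coordinatewise (hypothesis `hz`):
the index of the block of side `L` containing `x`, the blocks being centred at the points `c + L b`.
This is the defining sandwich `L z ≤ x - c + ⌊L/2⌋ < L z + L`. -/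
theorem blk_sandwich (hL : 1 ≤ L) (hz : ∀ x i, z x i = (x i - c i + ((L / 2 : ℕ) : ℤ)) / (L : ℤ))
    (x : Site d) (i : Fin d) :
    (L : ℤ) * z x i ≤ x i - c i + ((L / 2 : ℕ) : ℤ) ∧ x i - c i + ((L / 2 : ℕ) : ℤ) < (L : ℤ) * z x i + L := by
  have hL0 : (0 : ℤ) < L := by exact_mod_cast hL
  have h1 := Int.emod_nonneg (x i - c i + (L / 2 : ℕ)) hL0.ne'
  have h2 := Int.emod_lt_of_pos (x i - c i + (L / 2 : ℕ)) hL0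
  have h3 := Int.emod_add_mul_ediv (x i - c i + (L / 2 : ℕ)) (L : ℤ)
  rw [hz]
  constructor <;> omega

/-- The centre of the block of `x` is within sup-distance `⌊L/2⌋` of `x`. -/
theorem supDist_blkCentre_le (hL : 1 ≤ L) (hz : ∀ x i, z x i = (x i - c i + ((L / 2 : ℕ) : ℤ)) / (L : ℤ))
    (x : Site d) : supDist x (c + (L : ℤ) • z x) ≤ L / 2 := by
  refine supDist_le_iff.2 fun i => ?_
  have := blk_sandwich hL hz x i
  simp only [Pi.add_apply, Pi.smul_apply, smul_eq_mul]
  omega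

/-- Points at sup-distance `≤ 1` lie in equal or `★`-adjacent blocks. -/
theorem supDist_blkIdx_le_one (hL : 1 ≤ L) (hz : ∀ x i, z x i = (x i - c i + ((L / 2 : ℕ) : ℤ)) / (L : ℤ))
    {x y : Site d} (h : supDist x y ≤ 1) : supDist (z x) (z y) ≤ 1 := by
  refine supDist_le_iff.2 fun i => ?_
  have hi : x i - y i ≤ 1 ∧ y i - x i ≤ 1 := by have := (supDist_le_iff.1 h) i; omega
  have hL0 : (0 : ℤ) ≤ L := by positivity
  obtain ⟨h1, h2⟩ := blk_sandwich hL hz x i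
  obtain ⟨h3, h4⟩ := blk_sandwich hL hz y i
  have k1 : z x i - z y i < 2 := lt_of_mul_lt_mul_left (by linarith : (L : ℤ) * (z x i - z y i) < L * 2) hL0
  have k2 : z y i - z x i < 2 := lt_of_mul_lt_mul_left (by linarith : (L : ℤ) * (z y i - z x i) < L * 2) hL0
  omega

/-- A point within sup-distance `L²` of `c` lies in a block of index in `box L`. -/
theorem blkIdx_mem_box (hL : 1 ≤ L) (hz : ∀ x i, z x i = (x i - c i + ((L / 2 : ℕ) : ℤ)) / (L : ℤ))
    {a : Site d} (ha : supDist a c ≤ L ^ 2) : z a ∈ box d L := by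
  refine mem_box.2 fun i => ?_
  have hL0 : (0 : ℤ) ≤ L := by positivity
  obtain ⟨h1, h2⟩ := abs_sub_le_of_supDist_le ha i
  push_cast at h1 h2
  obtain ⟨h3, h4⟩ := blk_sandwich hL hz a i
  have hh : 2 * ((L / 2 : ℕ) : ℤ) ≤ L := by omega
  constructor <;> by_contra hlt
  · have := mul_le_mul_of_nonneg_left (show z a i ≤ -L - 1 by omega) hL0
    nlinarith
  · have := mul_le_mul_of_nonneg_left (show (L : ℤ) + 1 ≤ z a i by omega) hL0
    nlinarith

/-- **Block distance of the stopping point.** If `‖a - c‖_∞ ≤ L²` and `‖v - c‖_∞ = 3L² - 4L - 1`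
(`L ≥ 3`), the blocks of `v` and `a` are at sup-distance `≥ 2L - 5`. -/
theorem le_supDist_blkIdx (hL : 3 ≤ L) {c : Site 3} {z : Site 3 → Site 3}
    (hz : ∀ x i, z x i = (x i - c i + ((L / 2 : ℕ) : ℤ)) / (L : ℤ)) {a v : Site 3}
    (ha : supDist a c ≤ L ^ 2) (hv : supDist v c = 3 * L ^ 2 - 4 * L - 1) : 2 * L - 5 ≤ supDist (z v) (z a) := by
  obtain ⟨i, hi⟩ := exists_natAbs_eq_supDist v c
  refine le_trans ?_ (natAbs_sub_le_supDist _ _ i)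
  have hL0 : (0 : ℤ) < L := by exact_mod_cast (by omega : 0 < L)
  have hM : 3 * L ≤ L ^ 2 := by nlinarith
  obtain ⟨h1, h2⟩ := abs_sub_le_of_supDist_le ha i
  push_cast at h1 h2
  obtain ⟨h3, h4⟩ := blk_sandwich (by omega) hz a i
  obtain ⟨h3', h4'⟩ := blk_sandwich (by omega) hz v i
  have hcast : ((3 * L ^ 2 - 4 * L - 1 : ℕ) : ℤ) = 3 * (L : ℤ) ^ 2 - 4 * L - 1 := by
    have : 4 * L + 1 ≤ 3 * L ^ 2 := by omega
    push_cast [this, Nat.sub_sub]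
    ring
  have hvi : v i - c i = ((3 * L ^ 2 - 4 * L - 1 : ℕ) : ℤ) ∨
      v i - c i = -((3 * L ^ 2 - 4 * L - 1 : ℕ) : ℤ) := by omega
  rw [hcast] at hvi
  rcases hvi with hvi | hvi
  · have key : (L : ℤ) * (2 * L - 5) ≤ (L : ℤ) * (z v i - z a i) := by nlinarith
    have := le_of_mul_le_mul_left key hL0
    omega
  · have key : (L : ℤ) * (2 * L - 5) ≤ (L : ℤ) * (z a i - z v i) := by nlinarith
    have := le_of_mul_le_mul_left key hL0
    omega

/-- **A fine crossing from a vertex of the coarse crossing.** An open walk through `P`-vertices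
from `x` with `‖x - c‖_∞ ≤ 3L² - 4L - 1` to `b` with `‖b - c‖_∞ ≥ 3L²` contains, around the centre
`c_z = c + L z(x)` of the block of `x`, an open crossing through `P`-vertices of `c_z + box (3L)` from
`x ∈ c_z + box L` to a vertex at sup-distance exactly `3L` from `c_z`. -/
theorem fine_cross (hL : 3 ≤ L) {ω : BondConfig (Fin 3 → ℤ)} (hω : ∀ x y, (openGraph ω).Adj x y → (zdGraph 3).Adj x y)
    (P : (Fin 3 → ℤ) → Prop) (c : Fin 3 → ℤ) {z : (Fin 3 → ℤ) → (Fin 3 → ℤ)}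
    (hz : ∀ x i, z x i = (x i - c i + ((L / 2 : ℕ) : ℤ)) / (L : ℤ)) {x b : Fin 3 → ℤ} (p : (openGraph ω).Walk x b)
    (hP : ∀ y ∈ p.support, P y) (hx : supDist x c ≤ 3 * L ^ 2 - 4 * L - 1) (hb : 3 * L ^ 2 ≤ supDist b c) :
    ∃ a b' : Fin 3 → ℤ, a - (c + (L : ℤ) • z x) ∈ (box 3 L : Set (Fin 3 → ℤ)) ∧
      (∃ i, |b' i - (c + (L : ℤ) • z x) i| = 3 * L) ∧
      ω ∈ openConnIn {v | v - (c + (L : ℤ) • z x) ∈ (box 3 (3 * L) : Set (Fin 3 → ℤ)) ∧ P v} a b' := by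
  set cz : Fin 3 → ℤ := c + (L : ℤ) • z x with hcz
  have hM : 3 * L ≤ L ^ 2 := by nlinarith
  have h1 : supDist x cz ≤ L / 2 := supDist_blkCentre_le (by omega) hz x
  have h2 : 3 * L ≤ supDist b cz := by
    have t1 := supDist_triangle b cz c
    have t2 := supDist_triangle cz x c
    rw [supDist_comm cz x] at t2
    omega
  obtain ⟨y, p', hp'sub, hle, hy⟩ := exists_walk_hit (G := openGraph ω) (fun v => supDist v cz)
    (fun u v huv => supDist_le_succ_of_supDist_le_one (supDist_le_one_of_adj (hω u v huv)) cz)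
    (n := 3 * L) p (h1.trans (by omega)) h2
  have hS : ∀ w ∈ p'.support, w ∈ {v | v - cz ∈ (box 3 (3 * L) : Set (Fin 3 → ℤ)) ∧ P v} := fun w hw =>
    ⟨sub_mem_coe_box_iff.2 (hle w hw), hP w (hp'sub hw)⟩
  obtain ⟨i, hi⟩ := exists_natAbs_eq_supDist y cz
  refine ⟨x, y, sub_mem_coe_box_iff.2 (h1.trans (Nat.div_le_self L 2)), ⟨i, ?_⟩, ⟨_, _, ⟨p'.induce _ hS⟩⟩⟩
  rw [Int.abs_eq_natAbs, hi, hy]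
  push_cast
  ring

/-- **The cover.** A coarse crossing (scale `L²`, through `Q`-vertices) forces either a vertex of
`c + box (3L²)` which is `Q` but not `P`, or a block `z₀ ∈ box L` and a `★`-animal `Y ∋ z₀` of
`2L - 5` blocks each of which carries a fine crossing (scale `L`, through `P`-vertices). -/
theorem cross_cover (hL : 3 ≤ L) {ω : BondConfig (Fin 3 → ℤ)} (hω : ∀ x y, (openGraph ω).Adj x y → (zdGraph 3).Adj x y)
    (P Q : (Fin 3 → ℤ) → Prop) (c : Fin 3 → ℤ)
    (h : ∃ a b : Fin 3 → ℤ, a - c ∈ (box 3 (L ^ 2) : Set (Fin 3 → ℤ)) ∧ (∃ i, |b i - c i| = 3 * L ^ 2) ∧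
      ω ∈ openConnIn {v | v - c ∈ (box 3 (3 * L ^ 2) : Set (Fin 3 → ℤ)) ∧ Q v} a b) :
    (∃ w ∈ box 3 (3 * L ^ 2), ¬ P (c + w) ∧ Q (c + w)) ∨
      ∃ z₀ ∈ box 3 L, ∃ Y ∈ starAnimals z₀ (2 * L - 5), ∀ b ∈ Y,
        ∃ a b' : Fin 3 → ℤ, a - (c + (L : ℤ) • b) ∈ (box 3 L : Set (Fin 3 → ℤ)) ∧
          (∃ i, |b' i - (c + (L : ℤ) • b) i| = 3 * L) ∧
          ω ∈ openConnIn {v | v - (c + (L : ℤ) • b) ∈ (box 3 (3 * L) : Set (Fin 3 → ℤ)) ∧ P v} a b' := by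
  classical
  obtain ⟨a, b, ha, ⟨i₀, hi₀⟩, haR, hbR, ⟨γ⟩⟩ := h
  -- the coarse crossing as a walk `γ'` of the open graph with support in the coarse region
  obtain ⟨γ', hγ'R⟩ : ∃ γ' : (openGraph ω).Walk a b,
      ∀ v ∈ γ'.support, v - c ∈ (box 3 (3 * L ^ 2) : Set (Fin 3 → ℤ)) ∧ Q v := by
    have key : ∀ v ∈ (γ.map (Embedding.induce _).toHom).support,
        v - c ∈ (box 3 (3 * L ^ 2) : Set (Fin 3 → ℤ)) ∧ Q v := fun v hv => by
      rw [Walk.support_map, List.mem_map] at hv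
      obtain ⟨⟨w, hw⟩, -, rfl⟩ := hv
      exact hw
    exact ⟨_, key⟩
  by_cases hA : ∃ v ∈ γ'.support, ¬ P v
  · obtain ⟨v, hv, hPv⟩ := hA
    obtain ⟨hvbox, hQv⟩ := hγ'R v hv
    refine Or.inl ⟨v - c, Finset.mem_coe.1 hvbox, ?_, ?_⟩ <;> rw [add_sub_cancel] <;> assumption
  right
  push Not at hA
  have hL1 : 1 ≤ L := by omega
  have hM : 3 * L ≤ L ^ 2 := by nlinarith
  have hac : supDist a c ≤ L ^ 2 := sub_mem_coe_box_iff.1 ha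
  have hbc : 3 * L ^ 2 ≤ supDist b c := by
    rw [Int.abs_eq_natAbs] at hi₀
    exact (by exact_mod_cast hi₀ : (b i₀ - c i₀).natAbs = 3 * L ^ 2) ▸ natAbs_sub_le_supDist b c i₀
  -- the block index `z`, and the walk `W₀` stopped at sup-distance `3L² - 4L - 1` from `c`
  obtain ⟨z, hz⟩ : ∃ z : (Fin 3 → ℤ) → (Fin 3 → ℤ), ∀ x i, z x i = (x i - c i + ((L / 2 : ℕ) : ℤ)) / (L : ℤ) :=
    ⟨fun x i => (x i - c i + ((L / 2 : ℕ) : ℤ)) / (L : ℤ), fun _ _ => rfl⟩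
  obtain ⟨vs, W₀, hW₀sub, hW₀le, hvs⟩ := exists_walk_hit (G := openGraph ω) (fun y => supDist y c)
    (fun u v huv => supDist_le_succ_of_supDist_le_one (supDist_le_one_of_adj (hω u v huv)) c)
    (n := 3 * L ^ 2 - 4 * L - 1) γ' (hac.trans (by omega)) (le_trans (by omega) hbc)
  -- the block list of the stopped walk: a lazy `★`-chain from `z a` reaching block distance `2L - 5`
  set l : List (Fin 3 → ℤ) := W₀.support.map z with hl
  have hlchain : List.IsChain (fun a b => supDist a b ≤ 1) l :=
    List.isChain_map_of_isChain z
      (fun x y hxy => supDist_blkIdx_le_one hL1 hz (supDist_le_one_of_adj (hω x y hxy))) W₀.isChain_adj_support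
  obtain ⟨tl, htl⟩ : ∃ tl, l = z a :: tl := ⟨W₀.support.tail.map z, by rw [hl, ← W₀.cons_tail_support]; rfl⟩
  have hmeml : ∀ y, y ∈ l ↔ ∃ x ∈ W₀.support, z x = y := fun y => by rw [hl, List.mem_map]
  have hfar : 2 * L - 5 ≤ supDist (z vs) (z a) := le_supDist_blkIdx hL hz hac hvs
  -- so it meets at least `2L - 5` distinct blocks (one at each block distance `< 2L - 5`)
  have hcard : 2 * L - 5 ≤ l.toFinset.card := by
    rw [← Finset.card_range (2 * L - 5)]
    refine Finset.card_le_card_of_surjOn (fun y => supDist y (z a)) fun k hk => ?_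
    have hk' : k < 2 * L - 5 := Finset.mem_range.1 (Finset.mem_coe.1 hk)
    obtain ⟨y, hy, hyk⟩ : ∃ y ∈ l, supDist y (z a) = k := by
      rw [htl]
      refine exists_mem_apply_eq_of_isChain (fun y => supDist y (z a)) (z a) tl ?_ k (by simp) ?_
      · exact htl ▸ hlchain.imp fun u w huw => supDist_le_succ_of_supDist_le_one huw (z a)
      · exact ⟨z vs, htl ▸ (hmeml _).2 ⟨vs, W₀.end_mem_support, rfl⟩, by omega⟩
    exact ⟨y, by simpa using hy, hyk⟩
  -- a shortest prefix with exactly `2L - 5` blocks is the animal; its blocks are bad by `fine_cross`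
  obtain ⟨l₁, hl₁, hcard₁⟩ := exists_prefix_card_eq l (2 * L - 5) hcard
  have hmem₁ : z a ∈ l₁ := by
    rcases List.prefix_cons_iff.1 (htl ▸ hl₁) with rfl | ⟨t, rfl, -⟩
    · simp at hcard₁; omega
    · exact List.mem_cons_self
  refine ⟨z a, blkIdx_mem_box hL1 hz hac, l₁.toFinset, ?_, fun b hb => ?_⟩
  · rw [← hcard₁]
    refine mem_starAnimals (List.mem_toFinset.2 hmem₁) ?_
    rw [List.coe_toFinset]
    exact starConn_of_isChain (hlchain.prefix hl₁)
  · obtain ⟨x, hx, rfl⟩ := (hmeml b).1 (hl₁.subset (List.mem_toFinset.1 hb))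
    exact fine_cross hL hω P c hz (γ'.dropUntil x (hW₀sub hx))
      (fun y hy => hA y (Walk.support_dropUntil_subset_support γ' _ hy)) (hW₀le x hx) hbc

end ScaleStep

open ScaleStep in
/-- Registered stub `stub_scaleStep` of crux stmt-CriticalPhenomena-7204 (line vacant-coins-fresh-spine); see the line
skeleton `Cruxes/JumpFireBreak/Lines/vacant-coins-fresh-spine.lean` for the informal statement and sources. -/
theorem stub_scaleStep :
    ∀ (L r : ℕ), 3 ≤ L → r ≤ L → ∀ (q : ℝ) (c : Fin 3 → ℤ) (δ t : ℝ), 0 ≤ δ → δ ≤ 1 → 0 ≤ t →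
    (∀ T : Finset (Fin 3 → ℤ), (∀ x ∈ T, ∀ y ∈ T, x ≠ y → 8 < supDist x y) →
      (labelMeasure (Fin 3 → ℤ)).real (⋂ b ∈ T,
        {U | ∃ a b' : Fin 3 → ℤ, a - (c + (L : ℤ) • b) ∈ (box 3 L : Set (Fin 3 → ℤ)) ∧
          (∃ i, |b' i - (c + (L : ℤ) • b) i| = 3 * L) ∧
          configOfLabels q U (zdGraph 3) ∈
            openConnIn {v | v - (c + (L : ℤ) • b) ∈ (box 3 (3 * L) : Set (Fin 3 → ℤ)) ∧
              openCluster (configOfLabels (criticalProb (zdGraph 3) (0 : Fin 3 → ℤ)) U (zdGraph 3)) v ⊆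
                {y | y - v ∈ (box 3 r : Set (Fin 3 → ℤ))}} a b'}) ≤ δ ^ ((8 + 1) ^ 3 * T.card)) →
    (∀ v : Fin 3 → ℤ, (labelMeasure (Fin 3 → ℤ)).real
        {U | ¬ openCluster (configOfLabels (criticalProb (zdGraph 3) (0 : Fin 3 → ℤ)) U (zdGraph 3)) v ⊆
              {y | y - v ∈ (box 3 r : Set (Fin 3 → ℤ))} ∧
            openCluster (configOfLabels (criticalProb (zdGraph 3) (0 : Fin 3 → ℤ)) U (zdGraph 3)) v ⊆
              {y | y - v ∈ (box 3 L : Set (Fin 3 → ℤ))}} ≤ t) →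
    (labelMeasure (Fin 3 → ℤ)).real
        {U | ∃ a b : Fin 3 → ℤ, a - c ∈ (box 3 (L ^ 2) : Set (Fin 3 → ℤ)) ∧ (∃ i, |b i - c i| = 3 * L ^ 2) ∧
          configOfLabels q U (zdGraph 3) ∈
            openConnIn {v | v - c ∈ (box 3 (3 * L ^ 2) : Set (Fin 3 → ℤ)) ∧
              openCluster (configOfLabels (criticalProb (zdGraph 3) (0 : Fin 3 → ℤ)) U (zdGraph 3)) v ⊆
                {y | y - v ∈ (box 3 L : Set (Fin 3 → ℤ))}} a b} ≤
      (2 * (L : ℝ) + 1) ^ 3 * (((3 : ℝ) ^ 3 + 1) ^ (2 * ((2 * L - 5) - 1)) * δ ^ ((2 * L - 5) - ((8 + 1) ^ 3 - 1))) +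
        (6 * (L : ℝ) ^ 2 + 1) ^ 3 * t := by
  intro L r hL _hr q c δ t hδ0 hδ1 _ht H1 H2
  have hprob := isProbabilityMeasure_labelMeasure (Fin 3 → ℤ)
  -- `Sm ρ U v`: the level-`p_c` cluster of `v` stays within sup-distance `ρ` of `v`; `bad b`: the fine block `b` is bad
  let Sm : ℕ → (Sym2 (Fin 3 → ℤ) → ℝ) → (Fin 3 → ℤ) → Prop := fun ρ U v =>
    openCluster (configOfLabels (criticalProb (zdGraph 3) (0 : Fin 3 → ℤ)) U (zdGraph 3)) v ⊆
      {y | y - v ∈ (box 3 ρ : Set (Fin 3 → ℤ))}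
  let bad : (Fin 3 → ℤ) → Set (Sym2 (Fin 3 → ℤ) → ℝ) := fun b =>
    {U | ∃ a b' : Fin 3 → ℤ, a - (c + (L : ℤ) • b) ∈ (box 3 L : Set (Fin 3 → ℤ)) ∧
      (∃ i, |b' i - (c + (L : ℤ) • b) i| = 3 * L) ∧
      configOfLabels q U (zdGraph 3) ∈
        openConnIn {v | v - (c + (L : ℤ) • b) ∈ (box 3 (3 * L) : Set (Fin 3 → ℤ)) ∧ Sm r U v} a b'}
  -- the two union bounds (Case A over the translates; Case B over the block of `a`, Peierls bound for each)
  have hA : (labelMeasure (Fin 3 → ℤ)).real (⋃ w ∈ box 3 (3 * L ^ 2), {U | ¬ Sm r U (c + w) ∧ Sm L U (c + w)}) ≤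
      (6 * (L : ℝ) ^ 2 + 1) ^ 3 * t := by
    refine (measureReal_biUnion_finset_le _ _).trans
      ((Finset.sum_le_sum fun w _ => H2 (c + w)).trans (le_of_eq ?_))
    rw [Finset.sum_const, nsmul_eq_mul, card_box]
    push_cast
    ring
  have hB : (labelMeasure (Fin 3 → ℤ)).real
      (⋃ z₀ ∈ box 3 L, ⋃ Y ∈ starAnimals z₀ (2 * L - 5), ⋂ b ∈ Y, bad b) ≤ (2 * (L : ℝ) + 1) ^ 3 *
        (((3 : ℝ) ^ 3 + 1) ^ (2 * ((2 * L - 5) - 1)) * δ ^ ((2 * L - 5) - ((8 + 1) ^ 3 - 1))) := by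
    refine (measureReal_biUnion_finset_le _ _).trans ((Finset.sum_le_sum fun z₀ _ =>
      measureReal_exists_starAnimal_bad_le bad hδ0 hδ1 H1 z₀ (2 * L - 5)).trans (le_of_eq ?_))
    rw [Finset.sum_const, nsmul_eq_mul, card_box]
    push_cast
    ring
  refine (measureReal_mono (fun U hU => ?_)).trans ((measureReal_union_le _ _).trans (add_le_add hB hA))
  have hω : ∀ x y, (openGraph (configOfLabels q U (zdGraph 3))).Adj x y → (zdGraph 3).Adj x y :=
    fun x y hxy => ((openGraph_adj _ x y).1 hxy).1.1
  rcases cross_cover hL hω (Sm r U) (Sm L U) c hU with ⟨w, hw, hPw, hQw⟩ | ⟨z₀, hz₀, Y, hY, hbY⟩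
  · exact Or.inr (Set.mem_iUnion₂.2 ⟨w, hw, hPw, hQw⟩)
  · exact Or.inl (Set.mem_iUnion₂.2 ⟨z₀, hz₀, Set.mem_iUnion₂.2 ⟨Y, hY, Set.mem_iInter₂.2 hbY⟩⟩)

end Summit.CriticalPhenomena.PercolationContinuityZ3.Theorems

end
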